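import Summits.CriticalPhenomena.PercolationContinuityZ3.Theorems.PercNearOneGluingAdditiveGluingGenOfSurplusTransfer
import HarnessLib

/-!
# FK sub-lane: the UPPER CHAIN under an arbitrary measure, part 1 — (S5) ⇒ (GEN) for ANY probability measure with
# one-cluster conditional positive association (e.g. every random-cluster measure `φ_{w,q}`, `q ≥ 1`)

Support file (`--supports stmt-CriticalPhenomena-4575`), FK sub-lane `prim-bschramm-fk-2` (gen 2) of the post-continuity programme;
builds on p205010 (kernel theorem, internal audit signed; external expert review pending).  No named facts, no sorries, no `Prop`
definitions (the kernels (S5), (GEN), (AG-loc) appear as explicit HYPOTHESES, exactly as in the `q = 1` files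
`…AdditiveGluingOfAGloc.lean` / `…AdditiveGluingGenOfSurplusTransfer.lean` whose proofs are transplanted here); standard axioms.

WHAT IS PROVED (this file = part 1; part 2 `…FKUpperChain.lean` finishes (GEN) ⇒ (AG-loc) ⇒ AdditiveGluing and the FK corollary).  Fix a finite vertex type `Fin n` and a probability measure `μ` on bond configurations.  Write
`P^x_a := {x ↔ a} ∩ ⋂_{a' ∈ T, r a' < r a} {x ↮ a'}` (first-in-rank patterns of an injective rank `r`), `m_a := ∫ F(C(a)) dμ`,
`Sur_x(T) := ∫_{x ↔ T} F(C(x)) dμ − Σ_{a ∈ T} μ(P^x_a)·m_a`.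

* `sum_measureReal_firstRank_under` — the patterns partition `{o ↔ A}` under any finite measure (measure bookkeeping).
* `setIntegral_clusterFun_ge_of_cpa` — Harris for a monotone nonnegative function of ONE cluster and the event `{o ↔ a}`, from the
  one-cluster conditional positive association hypothesis at `X = ∅`.
* `gen_firstRank_of_surplusTransfer_under` — **(S5)_μ for relay sets of size `≤ K` ⟹ (GEN)_μ for relay sets of size `≤ K + 1`**, for every
  probability measure `μ` satisfying the one-cluster conditional positive association (vdBHK Thm 1.3 shape:
  `(∫_{s ↮ X} F(C_s))(∫_{s ↮ X} G(C_s)) ≤ μ(s ↮ X) ∫_{s ↮ X} F G` for increasing `F, G` of the open edge cluster): the `q = 1` induction of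
  `AGloc.gen_firstRank_of_surplusTransfer` verbatim, with `BHK2006_clusterConditionalPositiveAssociation_holds` replaced by the hypothesis.
* (part 2) `agloc_firstRank_of_gen_under`, `additiveGluingUnder_of_agloc_firstRank`, `additiveGluingUnder_of_surplusTransfer`,
  `additiveGluingFK_of_surplusTransferFK` — (GEN)_μ ⟹ (AG-loc)_μ ⟹ additive gluing under `μ`, and the corollary for `φ_{w,q}`, `q ≥ 1`,
  with van den Berg–Häggström–Kahn's Theorem 2.1/1.3 for the random-cluster measure (`BHK2006_clusterConditionalPositiveAssociation_rc`).

So of the chain CSH ⇒ (S5) ⇒ (GEN) ⇒ (AG-loc) ⇒ AdditiveGluing, everything above (S5) transplants to `φ_{w,q}`, `q ≥ 1`, as a tree theorem;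
the open research item of the sub-lane, `FK.AdditiveGluingFKMonotone` (= `∀ q ≥ 1, AdditiveGluingFK q`), is thereby REDUCED to the
surplus-transfer inequality (S5) for `φ_{w,q}` (census: 0 exact violations on all graphs with `n ≤ 6` vertices, `q ≤ 100`, three engines;
bschramm/FK-Q2.md §6).  Nothing is claimed about (S5) for `q ≠ 1`.
[cite: VandenbergHaggstromKahn2005, Thm. 1.3 (p. 6), Thm. 2.1 (p. 9)] [cite: KozmaNitzan2024, Conj. 1 (p. 3), Conj. 4 (p. 32)]
[cite: Grimmett2006, §1.4 eq. (1.20) (p. 15); Thm. (3.8)]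
-/

noncomputable section

namespace Summit.CriticalPhenomena.PercolationContinuityZ3.Theorems.FK

open MeasureTheory Set
open Literature.Probability.LatticeModels
open Literature.Probability.Percolation Literature.Probability.Percolation.KNPreFKG
open Summit.CriticalPhenomena.PercolationContinuityZ3.Theorems.AGloc (exists_rank_compat firstRank_disjoint firstRank_cover
  filter_erase_of_not)

variable {n : ℕ}

/-! ## Measure bookkeeping under an arbitrary finite measure -/

/-- The first-in-rank patterns have total measure `μ(o ↔ A)`, for any finite measure `μ`. [folklore] -/
theorem sum_measureReal_firstRank_under (μ : Measure (BondConfig (Fin n))) [IsFiniteMeasure μ] (A : Finset (Fin n))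
    (r : Fin n → ℕ) (o : Fin n) (hr : Set.InjOn r ↑A) :
    ∑ a ∈ A, μ.real (openConn o a ∩ ⋂ a' ∈ A.filter (fun a' => r a' < r a), (openConn o a')ᶜ : Set (BondConfig (Fin n))) =
      μ.real (⋃ a ∈ A, openConn o a) := by
  have hmeas : ∀ S : Set (BondConfig (Fin n)), MeasurableSet S := fun S => (Set.toFinite S).measurableSet
  rw [← firstRank_cover A r o, measureReal_biUnion_finset (firstRank_disjoint A r o hr) (fun a _ => hmeas _)
    (fun _ _ => measure_ne_top _ _)]

/-! ## Harris for one cluster, from the conditional positive association at `X = ∅` -/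

/-- **Harris for a function of one cluster**, from one-cluster conditional positive association at `X = ∅`: for `F` monotone
on vertex sets, `μ(o ↔ a) · ∫ F(C(a)) dμ ≤ ∫_{o ↔ a} F(C(o)) dμ` (on `{o ↔ a}` the two clusters agree).
[cite: VandenbergHaggstromKahn2005, Thm. 1.3 (p. 6) with X = ∅ ("Harris' inequality")] -/
theorem setIntegral_clusterFun_ge_of_cpa (μ : Measure (BondConfig (Fin n))) [IsProbabilityMeasure μ]
    (hCPA : ∀ (s : Fin n) (X : Set (Fin n)) (F G : Set (Sym2 (Fin n)) → ℝ), Monotone F → Monotone G → s ∉ X →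
      (∫ ω in {ω : BondConfig (Fin n) | ∀ x ∈ X, ¬ (openGraph ω).Reachable s x}, F (openEdgeCluster ω s) ∂μ) *
        (∫ ω in {ω : BondConfig (Fin n) | ∀ x ∈ X, ¬ (openGraph ω).Reachable s x}, G (openEdgeCluster ω s) ∂μ) ≤
      μ.real {ω : BondConfig (Fin n) | ∀ x ∈ X, ¬ (openGraph ω).Reachable s x} *
        ∫ ω in {ω : BondConfig (Fin n) | ∀ x ∈ X, ¬ (openGraph ω).Reachable s x},
          F (openEdgeCluster ω s) * G (openEdgeCluster ω s) ∂μ)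
    (a o : Fin n) (F : Set (Fin n) → ℝ) (hF : ∀ S T : Set (Fin n), S ⊆ T → F S ≤ F T) :
    μ.real (openConn o a) * ∫ ω, F (openCluster ω a) ∂μ ≤ ∫ ω in openConn o a, F (openCluster ω o) ∂μ := by
  classical
  have hmeas : ∀ S : Set (BondConfig (Fin n)), MeasurableSet S := fun _ => MeasurableSet.of_discrete
  have hD : {ω : BondConfig (Fin n) | ∀ x ∈ (∅ : Set (Fin n)), ¬ (openGraph ω).Reachable a x} = Set.univ := by
    ext ω; simp
  have key := hCPA a ∅ ((connFamily a o).indicator 1) (fun C => F {x | x = a ∨ ∃ e ∈ C, x ∈ e})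
    (monotone_indicator_one_of_isUpperSet (isUpperSet_connFamily a o)) (monotone_clusterFun a F hF) (Set.notMem_empty a)
  have hind : ∀ ω : BondConfig (Fin n), (connFamily a o).indicator (1 : Set (Sym2 (Fin n)) → ℝ) (openEdgeCluster ω a) =
      (openConn o a : Set (BondConfig (Fin n))).indicator (1 : BondConfig (Fin n) → ℝ) ω := fun ω => by
    rw [congrFun (indicator_comp_openEdgeCluster (connFamily a o) a) ω, ← openConn_eq_setOf_connFamily, openConn_symm a o]
  simp only [hD, Measure.restrict_univ, probReal_univ, one_mul, clusterFun_openEdgeCluster, hind] at key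
  rw [integral_indicator_one (hmeas _)] at key
  have hprod : ∫ ω, (openConn o a : Set (BondConfig (Fin n))).indicator (1 : BondConfig (Fin n) → ℝ) ω * F (openCluster ω a) ∂μ =
      ∫ ω in openConn o a, F (openCluster ω a) ∂μ := by
    have := setIntegral_mul_indicator_one μ Set.univ (openConn o a) (fun ω => F (openCluster ω a))
    simp only [Measure.restrict_univ, Set.univ_inter] at this
    rw [← this]
    refine integral_congr_ae (Filter.Eventually.of_forall fun ω => ?_)
    simp only [mul_comm]
  rw [hprod] at key
  refine key.trans (le_of_eq (setIntegral_congr_fun (hmeas _) fun ω hω => ?_))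
  exact congrArg F (openCluster_eq_of_reachable (hω : (openGraph ω).Reachable o a)).symm

/-! ## (S5)_μ ⟹ (GEN)_μ -/

/-- **(S5) ⟹ (GEN) under a probability measure with one-cluster conditional positive association.**  If the surplus-transfer
inequality `μ({v ↮ T} ∩ {o ↔ v})·Sur_v(T) ≤ μ(v ↮ T)·Sur_o(T)` holds under `μ` for every relay set of size `≤ K` (every observer `o`,
second observer `v ∉ T`, monotone nonnegative `F`, `m`-compatible injective rank), then the master form (GEN)
`Σ_{a ∈ A} μ(P_a)·m_a ≤ ∫_{o ↔ A} F(C(o)) dμ` holds under `μ` for every relay set of size `≤ K + 1`.  Induction on `|A|` removing the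
rank-maximal relay; the deficit is paid by one-cluster CPA given `{a_k ↮ T}` (hypothesis `hCPA`, vdBHK Thm 1.3 shape) and (S5) at `v = a_k` —
the tree's `AGloc.gen_firstRank_of_surplusTransfer` with the measure as a parameter. [cite: VandenbergHaggstromKahn2005, Thm. 1.3 (p. 6)]
[cite: KozmaNitzan2024, Conj. 4 (p. 32)] -/
theorem gen_firstRank_of_surplusTransfer_under (μ : Measure (BondConfig (Fin n))) [IsProbabilityMeasure μ]
    (hCPA : ∀ (s : Fin n) (X : Set (Fin n)) (F G : Set (Sym2 (Fin n)) → ℝ), Monotone F → Monotone G → s ∉ X →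
      (∫ ω in {ω : BondConfig (Fin n) | ∀ x ∈ X, ¬ (openGraph ω).Reachable s x}, F (openEdgeCluster ω s) ∂μ) *
        (∫ ω in {ω : BondConfig (Fin n) | ∀ x ∈ X, ¬ (openGraph ω).Reachable s x}, G (openEdgeCluster ω s) ∂μ) ≤
      μ.real {ω : BondConfig (Fin n) | ∀ x ∈ X, ¬ (openGraph ω).Reachable s x} *
        ∫ ω in {ω : BondConfig (Fin n) | ∀ x ∈ X, ¬ (openGraph ω).Reachable s x},
          F (openEdgeCluster ω s) * G (openEdgeCluster ω s) ∂μ)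
    (K : ℕ)
    (hS5 : ∀ (T : Finset (Fin n)) (o v : Fin n) (F : Set (Fin n) → ℝ) (r : Fin n → ℕ),
      T.card ≤ K → v ∉ T → (∀ S S' : Set (Fin n), S ⊆ S' → F S ≤ F S') → (∀ S, 0 ≤ F S) → Set.InjOn r ↑T →
      (∀ a ∈ T, ∀ a' ∈ T, r a < r a' → ∫ ω, F (openCluster ω a) ∂μ ≤ ∫ ω, F (openCluster ω a') ∂μ) →
      μ.real ({ω : BondConfig (Fin n) | ∀ a ∈ T, ¬ (openGraph ω).Reachable v a} ∩ openConn o v) *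
          (∫ ω in (⋃ a ∈ T, openConn v a), F (openCluster ω v) ∂μ -
            ∑ a ∈ T, μ.real (openConn v a ∩ ⋂ a' ∈ T.filter (fun a' => r a' < r a), (openConn v a')ᶜ : Set (BondConfig (Fin n))) *
              ∫ ω, F (openCluster ω a) ∂μ) ≤
        μ.real {ω : BondConfig (Fin n) | ∀ a ∈ T, ¬ (openGraph ω).Reachable v a} *
          (∫ ω in (⋃ a ∈ T, openConn o a), F (openCluster ω o) ∂μ -
            ∑ a ∈ T, μ.real (openConn o a ∩ ⋂ a' ∈ T.filter (fun a' => r a' < r a), (openConn o a')ᶜ : Set (BondConfig (Fin n))) *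
              ∫ ω, F (openCluster ω a) ∂μ)) :
    ∀ (A : Finset (Fin n)) (o : Fin n) (F : Set (Fin n) → ℝ) (r : Fin n → ℕ),
      A.card ≤ K + 1 → (∀ S S' : Set (Fin n), S ⊆ S' → F S ≤ F S') → (∀ S, 0 ≤ F S) → Set.InjOn r ↑A →
      (∀ a ∈ A, ∀ a' ∈ A, r a < r a' → ∫ ω, F (openCluster ω a) ∂μ ≤ ∫ ω, F (openCluster ω a') ∂μ) →
      ∑ a ∈ A, μ.real (openConn o a ∩ ⋂ a' ∈ A.filter (fun a' => r a' < r a), (openConn o a')ᶜ : Set (BondConfig (Fin n))) *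
          ∫ ω, F (openCluster ω a) ∂μ ≤
        ∫ ω in (⋃ a ∈ A, openConn o a), F (openCluster ω o) ∂μ := by
  induction K with
  | zero =>
    -- `|A| ≤ 1`: empty (trivial) or a singleton (Harris for one cluster)
    intro A o F r hA hF _ _ _
    classical
    rcases Nat.lt_or_ge A.card 1 with h0 | h1
    · have hA0 : A = ∅ := Finset.card_eq_zero.1 (Nat.lt_one_iff.1 h0)
      subst hA0
      simp
    · obtain ⟨a, hAa⟩ := Finset.card_eq_one.1 (le_antisymm hA h1)
      subst hAa
      have hf : ({a} : Finset (Fin n)).filter (fun a' => r a' < r a) = ∅ := by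
        rw [Finset.filter_eq_empty_iff]; intro x hx; rw [Finset.mem_singleton] at hx; subst hx; exact lt_irrefl _
      simp only [Finset.sum_singleton, hf, Finset.notMem_empty, Set.iInter_of_empty, Set.iInter_univ, Set.inter_univ,
        Finset.mem_singleton, Set.iUnion_iUnion_eq_left]
      exact setIntegral_clusterFun_ge_of_cpa μ hCPA a o F hF
  | succ K ih =>
    intro A o F r hA hF hF0 hr hcompat
    classical
    -- if `|A| ≤ K + 1` use the induction hypothesis directly
    by_cases hsmall : A.card ≤ K + 1
    · exact ih (fun T o v F r hT => hS5 T o v F r (hT.trans (Nat.le_succ K))) A o F r hsmall hF hF0 hr hcompat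
    have hcard : A.card = K + 2 := by omega
    have hne : A.Nonempty := Finset.card_pos.1 (by omega)
    -- the rank-maximal relay `k` and `T = A.erase k`
    obtain ⟨k, hkA, hkmax⟩ := Finset.exists_max_image A r hne
    set T : Finset (Fin n) := A.erase k with hT
    have hTcard : T.card ≤ K + 1 := by rw [hT, Finset.card_erase_of_mem hkA]; omega
    have hTA : ∀ a ∈ T, a ∈ A := fun a ha => Finset.mem_of_mem_erase ha
    have hkT : k ∉ T := Finset.notMem_erase k A
    have hlt : ∀ a ∈ T, r a < r k := by
      intro a ha
      rcases (hkmax a (hTA a ha)).lt_or_eq with h | h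
      · exact h
      · exact absurd (hr (hTA a ha) hkA h) (Finset.ne_of_mem_erase ha)
    have hrT : Set.InjOn r ↑T := hr.mono (by intro a ha; exact hTA a ha)
    have hcompatT : ∀ a ∈ T, ∀ a' ∈ T, r a < r a' →
        ∫ ω, F (openCluster ω a) ∂μ ≤ ∫ ω, F (openCluster ω a') ∂μ :=
      fun a ha a' ha' h => hcompat a (hTA a ha) a' (hTA a' ha') h
    -- (GEN) for `T` (induction hypothesis) and (S5) for `(o, k, T)`
    have hGenT := ih (fun T o v F r hT' => hS5 T o v F r (hT'.trans (Nat.le_succ K))) T o F r hTcard hF hF0 hrT hcompatT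
    have hS5k := hS5 T o k F r hTcard hkT hF hF0 hrT hcompatT
    set f₀ : BondConfig (Fin n) → ℝ := fun ω => F (openCluster ω o) with hf₀
    set fk : BondConfig (Fin n) → ℝ := fun ω => F (openCluster ω k) with hfk
    set mk : ℝ := ∫ ω, fk ω ∂μ with hmk
    have hmeas : ∀ S : Set (BondConfig (Fin n)), MeasurableSet S := fun _ => MeasurableSet.of_discrete
    have hint : ∀ (g : BondConfig (Fin n) → ℝ) (S : Set (BondConfig (Fin n))), IntegrableOn g S μ :=
      fun g S => (Integrable.of_finite).integrableOn
    have hn := fun (S : Set (BondConfig (Fin n))) => (measureReal_nonneg : 0 ≤ μ.real S)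
    set UT : Set (BondConfig (Fin n)) := ⋃ a ∈ T, openConn o a with hUT
    set Ok : Set (BondConfig (Fin n)) := openConn o k with hOk
    set Dk : Set (BondConfig (Fin n)) := {ω : BondConfig (Fin n) | ∀ a ∈ T, ¬ (openGraph ω).Reachable k a} with hDk
    set Wk : Set (BondConfig (Fin n)) := ⋃ a ∈ T, openConn k a with hWk
    set pat : Fin n → Fin n → Set (BondConfig (Fin n)) := fun x a =>
      (openConn x a ∩ ⋂ a' ∈ T.filter (fun a' => r a' < r a), (openConn x a')ᶜ : Set (BondConfig (Fin n))) with hpat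
    -- patterns over `A`: for `a ∈ T` they are the `T`-patterns, for `k` it is `Ok ∩ Dk`
    have hfiltT : ∀ a ∈ T, A.filter (fun a' => r a' < r a) = T.filter (fun a' => r a' < r a) := by
      intro a ha
      rw [hT, filter_erase_of_not]
      exact fun h => lt_asymm h (hlt a ha)
    have hfiltk : A.filter (fun a' => r a' < r k) = T := by
      ext a
      simp only [Finset.mem_filter, hT, Finset.mem_erase]
      constructor
      · rintro ⟨ha, h⟩; exact ⟨fun hak => lt_irrefl _ (hak ▸ h), ha⟩
      · rintro ⟨hak, ha⟩; exact ⟨ha, hlt a (Finset.mem_erase.2 ⟨hak, ha⟩)⟩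
    have hPk : (openConn o k ∩ ⋂ a' ∈ A.filter (fun a' => r a' < r k), (openConn o a')ᶜ : Set (BondConfig (Fin n))) = Dk ∩ Ok := by
      rw [hfiltk]
      ext ω
      simp only [hDk, hOk, mem_inter_iff, mem_iInter, mem_compl_iff, openConn, mem_setOf_eq]
      constructor
      · rintro ⟨hk', h⟩
        exact ⟨fun a ha hka => h a ha (hk'.trans hka), hk'⟩
      · rintro ⟨h, hk'⟩
        exact ⟨hk', fun a ha hoa => h a ha (hk'.symm.trans hoa)⟩
    have hsumA : ∑ a ∈ A, μ.real (openConn o a ∩ ⋂ a' ∈ A.filter (fun a' => r a' < r a), (openConn o a')ᶜ : Set (BondConfig (Fin n))) *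
          ∫ ω, F (openCluster ω a) ∂μ =
        ∑ a ∈ T, μ.real (pat o a) * ∫ ω, F (openCluster ω a) ∂μ + μ.real (Dk ∩ Ok) * mk := by
      rw [← Finset.add_sum_erase A _ hkA, hPk, add_comm]
      congr 1
      refine Finset.sum_congr rfl fun a ha => ?_
      rw [hfiltT a ha]
    -- the union over `A` splits as `UT ∪ Ok`, and `(UT ∪ Ok) \ UT = Dk ∩ Ok`
    have hUA : (⋃ a ∈ A, (openConn o a : Set (BondConfig (Fin n)))) = UT ∪ Ok := by
      ext ω
      simp only [hUT, hOk, mem_iUnion, mem_union, exists_prop, hT, Finset.mem_erase]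
      constructor
      · rintro ⟨a, ha, h⟩
        by_cases hak : a = k
        · exact Or.inr (hak ▸ h)
        · exact Or.inl ⟨a, ⟨hak, ha⟩, h⟩
      · rintro (⟨a, ⟨_, ha⟩, h⟩ | h)
        · exact ⟨a, ha, h⟩
        · exact ⟨k, hkA, h⟩
    have h0k : ∀ ω ∈ Ok, f₀ ω = fk ω := fun ω hω => by
      simp only [hf₀, hfk]; rw [openCluster_eq_of_reachable (hω : (openGraph ω).Reachable o k)]
    have hdiff : (UT ∪ Ok) \ UT = Dk ∩ Ok := by
      ext ω
      simp only [hUT, hOk, hDk, mem_sdiff, mem_union, mem_iUnion, mem_inter_iff, exists_prop, not_exists, not_and, openConn,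
        mem_setOf_eq]
      constructor
      · rintro ⟨h | h, hno⟩
        · obtain ⟨a, ha, h'⟩ := h; exact absurd h' (hno a ha)
        · exact ⟨fun a ha hka => hno a ha (h.trans hka), h⟩
      · rintro ⟨hd, hk'⟩
        exact ⟨Or.inr hk', fun a ha hoa => hd a ha (hk'.symm.trans hoa)⟩
    have hsplit : ∫ ω in UT ∪ Ok, f₀ ω ∂μ = ∫ ω in UT, f₀ ω ∂μ + ∫ ω in Dk ∩ Ok, fk ω ∂μ := by
      rw [← integral_inter_add_sdiff (hmeas UT) (hint f₀ (UT ∪ Ok)), inter_eq_right.2 subset_union_left, hdiff,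
        setIntegral_congr_fun (hmeas (Dk ∩ Ok)) fun ω hω => h0k ω hω.2]
    -- one-cluster CPA for `C(k)` given `k ↮ T`
    have hindk : ∀ ω : BondConfig (Fin n), (connFamily k o).indicator (1 : Set (Sym2 (Fin n)) → ℝ) (openEdgeCluster ω k) =
        Ok.indicator (1 : BondConfig (Fin n) → ℝ) ω := fun ω => by
      rw [congrFun (indicator_comp_openEdgeCluster (connFamily k o) k) ω, ← openConn_eq_setOf_connFamily, openConn_symm k o]
    have hprod : ∀ (S : Set (BondConfig (Fin n))) (g : BondConfig (Fin n) → ℝ),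
        ∫ ω in Dk, S.indicator (1 : BondConfig (Fin n) → ℝ) ω * g ω ∂μ = ∫ ω in Dk ∩ S, g ω ∂μ := by
      intro S g
      rw [← setIntegral_mul_indicator_one μ Dk S g]
      refine setIntegral_congr_fun (hmeas Dk) fun ω _ => ?_
      ring
    have hDset : {ω : BondConfig (Fin n) | ∀ x ∈ (↑T : Set (Fin n)), ¬ (openGraph ω).Reachable k x} = Dk := by
      ext ω; simp [hDk]
    have hBHK := hCPA k (↑T : Set (Fin n)) ((connFamily k o).indicator 1) (fun C => F {a | a = k ∨ ∃ e ∈ C, a ∈ e})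
      (monotone_indicator_one_of_isUpperSet (isUpperSet_connFamily k o)) (monotone_clusterFun k F hF)
      (by exact_mod_cast hkT)
    simp only [hDset, clusterFun_openEdgeCluster, hindk] at hBHK
    rw [setIntegral_indicator_one_eq, hprod Ok] at hBHK
    change μ.real (Dk ∩ Ok) * ∫ ω in Dk, fk ω ∂μ ≤ μ.real Dk * ∫ ω in Dk ∩ Ok, fk ω ∂μ at hBHK
    -- `Dk = Wkᶜ`
    have hDW : Dk = Wkᶜ := by
      ext ω
      simp [hDk, hWk, openConn]
    have hDint : ∫ ω in Dk, fk ω ∂μ = mk - ∫ ω in Wk, fk ω ∂μ := by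
      have := integral_add_compl (hmeas Wk) (Integrable.of_finite (f := fk) (μ := μ))
      rw [← hDW] at this
      linarith
    have hDμ : μ.real Dk = 1 - μ.real Wk := by
      have h1 : μ.real (univ : Set (BondConfig (Fin n))) = μ.real (univ ∩ Wk) + μ.real (univ \ Wk) :=
        (measureReal_inter_add_sdiff (s := univ) (h := measure_ne_top _ _) (hmeas Wk)).symm
      rw [probReal_univ, univ_inter, ← compl_eq_univ_sdiff, ← hDW] at h1
      linarith
    -- `Cov(fk, 1_{Wk}) ≤ Sur_k(T)` since `m_k` is maximal on `A`
    have hWsum : ∑ a ∈ T, μ.real (pat k a) = μ.real Wk := sum_measureReal_firstRank_under μ T r k hrT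
    have hmle : ∀ a ∈ T, ∫ ω, F (openCluster ω a) ∂μ ≤ mk := fun a ha => hcompat a (hTA a ha) k hkA (hlt a ha)
    have hCovSur : ∫ ω in Wk, fk ω ∂μ - mk * μ.real Wk ≤
        ∫ ω in Wk, fk ω ∂μ - ∑ a ∈ T, μ.real (pat k a) * ∫ ω, F (openCluster ω a) ∂μ := by
      have : ∑ a ∈ T, μ.real (pat k a) * ∫ ω, F (openCluster ω a) ∂μ ≤ ∑ a ∈ T, μ.real (pat k a) * mk :=
        Finset.sum_le_sum fun a ha => mul_le_mul_of_nonneg_left (hmle a ha) (hn _)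
      rw [← Finset.sum_mul, hWsum] at this
      linarith
    -- assemble
    have hmkn : 0 ≤ mk := integral_nonneg fun ω => hF0 _
    have hPint : 0 ≤ ∫ ω in Dk ∩ Ok, fk ω ∂μ := setIntegral_nonneg (hmeas _) fun ω _ => hF0 _
    change μ.real (Dk ∩ Ok) * (∫ ω in Wk, fk ω ∂μ - ∑ a ∈ T, μ.real (pat k a) * ∫ ω, F (openCluster ω a) ∂μ) ≤
      μ.real Dk * (∫ ω in UT, f₀ ω ∂μ - ∑ a ∈ T, μ.real (pat o a) * ∫ ω, F (openCluster ω a) ∂μ) at hS5k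
    change ∑ a ∈ T, μ.real (pat o a) * ∫ ω, F (openCluster ω a) ∂μ ≤ ∫ ω in UT, f₀ ω ∂μ at hGenT
    have hkey : μ.real Dk * (mk * μ.real (Dk ∩ Ok) - ∫ ω in Dk ∩ Ok, fk ω ∂μ) ≤
        μ.real Dk * (∫ ω in UT, f₀ ω ∂μ - ∑ a ∈ T, μ.real (pat o a) * ∫ ω, F (openCluster ω a) ∂μ) := by
      have h1 : μ.real Dk * (mk * μ.real (Dk ∩ Ok) - ∫ ω in Dk ∩ Ok, fk ω ∂μ) ≤
          μ.real (Dk ∩ Ok) * (∫ ω in Wk, fk ω ∂μ - mk * μ.real Wk) := by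
        rw [hDint, hDμ] at hBHK
        rw [hDμ]
        nlinarith [hBHK]
      have h2 := mul_le_mul_of_nonneg_left hCovSur (hn (Dk ∩ Ok))
      linarith
    have hgoal : 0 ≤ (∫ ω in UT, f₀ ω ∂μ - ∑ a ∈ T, μ.real (pat o a) * ∫ ω, F (openCluster ω a) ∂μ) -
        (mk * μ.real (Dk ∩ Ok) - ∫ ω in Dk ∩ Ok, fk ω ∂μ) := by
      by_cases hD0 : μ.real Dk = 0
      · have hP0 : μ.real (Dk ∩ Ok) = 0 :=
          le_antisymm (hD0 ▸ measureReal_mono inter_subset_left (measure_ne_top _ _)) (hn _)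
        rw [hP0]
        nlinarith [hGenT, hPint]
      · have hDpos : 0 < μ.real Dk := lt_of_le_of_ne (hn _) (Ne.symm hD0)
        by_contra hneg
        have := mul_neg_of_pos_of_neg hDpos (lt_of_not_ge hneg)
        nlinarith [hkey]
    rw [hsumA, hUA, hsplit]
    linarith

end Summit.CriticalPhenomena.PercolationContinuityZ3.Theorems.FK

end
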